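import Literature.NumberTheory.Transcendental.BinomialAntiEFunction
import HarnessLib

/-!
# The Э-function `β − ∑ s(s−1)⋯(s−n+1) cⁿzⁿ` (`s ∈ ℚ`; `c, β ∈ ℚ̄`) is an Э-function

`Literature/NumberTheory/Transcendental/BinomialAntiEFunctionShift.lean` — everything PROVED.
Companion of `BinomialAntiEFunction.lean` (`chooseSeq s c n = C(s,n) cⁿ` is a strict
`E`-coefficient sequence): for algebraic `β` the sequence `gₙ = β·δ_{n0} − C(s,n) cⁿ`, i.e. the
Э-series `β − 𝔣(cz)` with `𝔣 = ∑ s(s−1)⋯(s−n+1) zⁿ`, is again a strict `E`-coefficient sequence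
(`isStrictEFunction_diffSeq`): its `E`-function `G = β − F` satisfies the third-order equation
`(c − sc)G′ + (2 + cz)G″ + zG‴ = 0` (`chooseSeq_ode_deriv`, the derivative of the Kummer-type
equation of `F`), its conjugates are `σ(β) − 1` and `−C(s,n)σ(c)ⁿ`, its denominators those of
`F` times `d²` (`dβ ∈ O_ℚ̄`) — Rivoal's Définition 5.2 checked conjunct by conjunct (the tree has
no general closure of `IsStrictEFunction` under sums yet, so the instance is done by hand).
This is the Э-function to which Conjecture 2 is applied in the proof of
[FischlerRivoal2024, Proposition 4] for the system `ᵗ(1, 𝔣)` at the point `1/α` (`c = α⁻¹`,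
`β = 𝔣₀(1/α)` supposed algebraic); used in `FischlerRivoalCorollary1Reduction.lean`.

## References

* [FischlerRivoal2024] S. Fischler, T. Rivoal, J. Number Theory 261 (2024), §5.1
  (Proposition 4), §5.2.
* [Rivoal2024] T. Rivoal, *Les E-fonctions et G-fonctions de Siegel*, Définition 5.2.
-/

noncomputable section

open Complex MeasureTheory Set Filter Real Finset
open scoped Nat Topology

namespace Literature.NumberTheory.Transcendental

open Literature.Barriers.Schanuel
open Literature.RingTheory.Binomial

/-! ### The Э-function `β − 𝔣(cz)` -/

variable (s : ℚ) (c β : ℂ)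

/-- The coefficient sequence of `β − ∑ n! C(s,n) cⁿ zⁿ`: `gₙ = β·δ_{n0} − C(s,n) cⁿ`.
[cite: FischlerRivoal2024, §5.1 (Proposition 4)] -/
theorem diffSeq_apply_zero :
    (fun n => β * deltaZero n - chooseSeq s c n) 0 = β - 1 := by
  simp [chooseSeq]

/-- The shifted coefficients of `g` are those of `−a`: `g_{n+k+1} = −C(s,n+k+1)c^{n+k+1}`. [folklore] -/
theorem diffSeq_add_succ (n k : ℕ) :
    (fun n => β * deltaZero n - chooseSeq s c n) (n + (k + 1)) =
      (-1) * chooseSeq s c (n + (k + 1)) := by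
  have : deltaZero (n + (k + 1)) = 0 := deltaZero_of_ne_zero (by omega)
  simp [this]

/-- Geometric growth of `g`. [folklore] -/
theorem expBound_diffSeq : ExpBound fun n => β * deltaZero n - chooseSeq s c n := by
  have h1 : ExpBound fun n => β * deltaZero n :=
    (ExpBound.of_eventually_zero (N := 1) fun n hn =>
      deltaZero_of_ne_zero (by omega)).const_mul β
  have h2 := (expBound_chooseSeq s c).const_mul (-1)
  refine (h1.add h2).of_norm_le fun n => le_of_eq ?_
  congr 1
  ring

/-- **The third-order equation for `F′`**: with `F = ∑ C(s,n)cⁿzⁿ/n!`,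
`(c − sc) F′ + (2 + cz) F″ + z F‴ = 0` (the derivative of the Kummer-type equation
`zF″ + (1+cz)F′ − scF = 0`). PROVED. [folklore] -/
theorem chooseSeq_ode_deriv (z : ℂ) :
    (c - (s : ℂ) * c) * iteratedDeriv 1 (eSeries (chooseSeq s c)) z
      + (2 + c * z) * iteratedDeriv 2 (eSeries (chooseSeq s c)) z
      + z * iteratedDeriv 3 (eSeries (chooseSeq s c)) z = 0 := by
  have ha := expBound_chooseSeq s c
  rw [iteratedDeriv_eSeries ha 1, iteratedDeriv_eSeries ha 2, iteratedDeriv_eSeries ha 3]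
  have h3 : z * eSeries (fun n => chooseSeq s c (n + 3)) z =
      eSeries (fun n => (n : ℂ) * chooseSeq s c (n + 2)) z := by
    rw [(ha.shift_iterate 3).mul_eSeries]
    congr 1
    funext n
    rcases n with _ | n
    · simp
    · simp
  have h2 : (2 + c * z) * eSeries (fun n => chooseSeq s c (n + 2)) z =
      2 * eSeries (fun n => chooseSeq s c (n + 2)) z
        + c * eSeries (fun n => (n : ℂ) * chooseSeq s c (n + 1)) z := by
    rw [add_mul, mul_assoc, (ha.shift_iterate 2).mul_eSeries]
    congr 3
    funext n
    rcases n with _ | n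
    · simp
    · simp
  rw [h3, h2]
  have hb1 : ExpBound fun n => chooseSeq s c (n + 1) := ha.shift_iterate 1
  have hb2 : ExpBound fun n => chooseSeq s c (n + 2) := ha.shift_iterate 2
  have hb3 : ExpBound fun n => (n : ℂ) * chooseSeq s c (n + 1) :=
    (ha.shift_iterate 2).mulX.of_norm_le fun n => by rcases n with _ | n <;> simp
  have hb4 : ExpBound fun n => (n : ℂ) * chooseSeq s c (n + 2) :=
    (ha.shift_iterate 3).mulX.of_norm_le fun n => by rcases n with _ | n <;> simp
  have H := (((hasSum_eSeries hb1 z).mul_left (c - (s : ℂ) * c)).add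
    (((hasSum_eSeries hb2 z).mul_left 2).add ((hasSum_eSeries hb3 z).mul_left c))).add
    (hasSum_eSeries hb4 z)
  have hzero : (fun n : ℕ => (c - (s : ℂ) * c) * (chooseSeq s c (n + 1) * z ^ n / (n ! : ℂ))
      + (2 * (chooseSeq s c (n + 2) * z ^ n / (n ! : ℂ))
        + c * ((n : ℂ) * chooseSeq s c (n + 1) * z ^ n / (n ! : ℂ)))
      + (n : ℂ) * chooseSeq s c (n + 2) * z ^ n / (n ! : ℂ)) = fun _ => 0 := by
    funext n
    have := chooseSeq_succ s c (n + 1)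
    have hn : (n ! : ℂ) ≠ 0 := by exact_mod_cast n.factorial_ne_zero
    field_simp
    push_cast at this
    rw [show n + 1 + 1 = n + 2 by ring] at this
    linear_combination z ^ n * this
  rw [hzero] at H
  have := H.unique hasSum_zero
  linear_combination this

attribute [-instance] DivisionRing.toRatAlgebra in
/-- Condition (ii) for `g`: the conjugates of `g₀ = β − 1` are finitely many, those of
`gₙ = −C(s,n)cⁿ` (`n ≥ 1`) are `−C(s,n)σ(c)ⁿ`. [cite: Rivoal2024, Définition 5.2] -/
theorem norm_conj_diffSeq_le (hc : IsAlgebraic ℚ c) :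
    ∃ C : ℝ, 0 < C ∧ ∀ n, ∀ b ∈ (minpoly ℚ ((fun n => β * deltaZero n - chooseSeq s c n) n)).rootSet ℂ,
      ‖b‖ ≤ C ^ (n + 1) := by
  obtain ⟨C, hC, hconj⟩ := norm_conj_chooseSeq_le s c hc
  obtain ⟨M, hM⟩ : ∃ M : ℝ, ∀ b ∈ (minpoly ℚ (β - 1)).rootSet ℂ, ‖b‖ ≤ M := by
    obtain ⟨M, hM⟩ := ((Polynomial.rootSet_finite (minpoly ℚ (β - 1)) ℂ).image
      fun b => ‖b‖).bddAbove
    exact ⟨M, fun b hb => hM (Set.mem_image_of_mem _ hb)⟩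
  refine ⟨max C (max M 1), lt_max_of_lt_left hC, fun n b hb => ?_⟩
  rcases n with _ | n
  · have hg0 : (fun n => β * deltaZero n - chooseSeq s c n) 0 = β - 1 := by simp [chooseSeq]
    rw [hg0] at hb
    calc ‖b‖ ≤ M := hM b hb
      _ ≤ max C (max M 1) := (le_max_left _ _).trans (le_max_right _ _)
      _ = (max C (max M 1)) ^ (0 + 1) := by rw [zero_add, pow_one]
  · have hgS : (fun n => β * deltaZero n - chooseSeq s c n) (n + 1) = -chooseSeq s c (n + 1) := by
      simp [deltaZero_of_ne_zero (Nat.succ_ne_zero n)]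
    rw [hgS] at hb
    -- `b = ψ(−aₙ) = −ψ(aₙ)` for an embedding `ψ`
    set Qb := algebraicClosure ℚ ℂ
    have hmem : chooseSeq s c (n + 1) ∈ Qb :=
      mem_algebraicClosure_iff.mpr (isAlgebraic_chooseSeq s c hc _)
    have hmem' : -chooseSeq s c (n + 1) ∈ Qb := neg_mem hmem
    obtain ⟨ψ, hψ⟩ := exists_algHom_apply_eq_of_mem_rootSet hmem' hb
    have hneg : (⟨-chooseSeq s c (n + 1), hmem'⟩ : Qb) = -⟨chooseSeq s c (n + 1), hmem⟩ := rfl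
    rw [← hψ, hneg, map_neg, norm_neg]
    calc ‖ψ ⟨chooseSeq s c (n + 1), hmem⟩‖ ≤ C ^ (n + 1 + 1) :=
          hconj (n + 1) _ (algHom_apply_mem_rootSet ψ ⟨_, hmem⟩)
      _ ≤ (max C (max M 1)) ^ (n + 1 + 1) :=
          pow_le_pow_left₀ hC.le (le_max_left _ _) _

/-- Condition (iii) for `g`: denominators `d² Dₙ`, where `Dₙ` serves `(C(s,m)cᵐ)_{m ≤ n}` and
`dβ ∈ O_ℚ̄`. [cite: Rivoal2024, Définition 5.2] -/
theorem exists_den_diffSeq (hc : IsAlgebraic ℚ c) (hβ : IsAlgebraic ℚ β) :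
    ∃ (D : ℕ → ℤ) (D₀ : ℝ), 0 < D₀ ∧ ∀ n, 1 ≤ D n ∧ (D n : ℝ) ≤ D₀ ^ (n + 1) ∧
      ∀ m ≤ n, IsIntegral ℤ ((D n : ℂ) * (fun n => β * deltaZero n - chooseSeq s c n) m) := by
  obtain ⟨D, D₀, hD₀, hD⟩ := exists_den_chooseSeq s c hc
  have hβℤ : IsAlgebraic ℤ β := (IsFractionRing.isAlgebraic_iff ℤ ℚ ℂ).mpr hβ
  obtain ⟨d, hd, hint⟩ := hβℤ.exists_integral_multiple
  rw [Algebra.smul_def, eq_intCast] at hint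
  have hd1 : (1 : ℤ) ≤ d ^ 2 := (one_le_sq_iff_one_le_abs d).mpr (Int.one_le_abs hd)
  refine ⟨fun n => d ^ 2 * D n, ((d ^ 2 : ℤ) : ℝ) * D₀, by positivity, fun n => ⟨?_, ?_, ?_⟩⟩
  · have := (hD n).1
    nlinarith
  · obtain ⟨h1, h2, -⟩ := hD n
    push_cast
    rw [mul_pow]
    have hdd : ((d : ℝ) ^ 2) ≤ ((d : ℝ) ^ 2) ^ (n + 1) := by
      have : (1 : ℝ) ≤ (d : ℝ) ^ 2 := by exact_mod_cast hd1
      exact le_self_pow₀ this (Nat.succ_ne_zero n)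
    have hDpos : (0 : ℝ) ≤ D n := by exact_mod_cast (show (0 : ℤ) ≤ D n by omega)
    calc (d : ℝ) ^ 2 * (D n : ℝ) ≤ (d : ℝ) ^ 2 * D₀ ^ (n + 1) := by gcongr
      _ ≤ ((d : ℝ) ^ 2) ^ (n + 1) * D₀ ^ (n + 1) := by gcongr
  · intro m hm
    obtain ⟨-, -, h3⟩ := hD n
    have hdint : IsIntegral ℤ ((d : ℤ) : ℂ) := by
      simpa using isIntegral_algebraMap (R := ℤ) (A := ℂ) (x := d)
    have hDint : IsIntegral ℤ ((D n : ℤ) : ℂ) := by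
      simpa using isIntegral_algebraMap (R := ℤ) (A := ℂ) (x := D n)
    rcases m with _ | m
    · have hg0 : (fun n => β * deltaZero n - chooseSeq s c n) 0 = β - 1 := by simp [chooseSeq]
      rw [hg0]
      have : (((d ^ 2 * D n : ℤ)) : ℂ) * (β - 1) =
          (D n : ℂ) * ((d : ℂ) * ((d : ℂ) * β)) - (d : ℂ) * (d : ℂ) * (D n : ℂ) := by
        push_cast; ring
      rw [this]
      exact ((hDint.mul (hdint.mul hint)).sub ((hdint.mul hdint).mul hDint))
    · have hgS : (fun n => β * deltaZero n - chooseSeq s c n) (m + 1) = -chooseSeq s c (m + 1) := by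
        simp [deltaZero_of_ne_zero (Nat.succ_ne_zero m)]
      rw [hgS]
      have : (((d ^ 2 * D n : ℤ)) : ℂ) * -chooseSeq s c (m + 1) =
          -((d : ℂ) * (d : ℂ)) * ((D n : ℂ) * chooseSeq s c (m + 1)) := by
        push_cast; ring
      rw [this]
      exact ((hdint.mul hdint).neg).mul (h3 (m + 1) hm)

/-- **`β − 𝔣(z/α)` is an Э-function**: for `s ∈ ℚ` and algebraic `c`, `β`, the sequence
`gₙ = β δ_{n0} − C(s,n) cⁿ` is a strict `E`-coefficient sequence — the `E`-function
`G = β − F` satisfies `(c − sc)G′ + (2 + cz)G″ + zG‴ = 0`, its conjugates are `σ(β) − 1` and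
`−C(s,n)σ(c)ⁿ`, its denominators those of `F` times `d²` (`dβ ∈ O_ℚ̄`). This is the Э-function
to which Conjecture 2 is applied in the proof of Proposition 4 / Theorem 3 for `ᵗ(1, 𝔣)` at the
point `1/α` (`c = α⁻¹`, `β = 𝔣₀(1/α)` if that value were algebraic). PROVED.
[cite: FischlerRivoal2024, §5.1 (Proposition 4)] -/
theorem isStrictEFunction_diffSeq (hc : IsAlgebraic ℚ c) (hβ : IsAlgebraic ℚ β) :
    IsStrictEFunction fun n => β * deltaZero n - chooseSeq s c n := by
  set g : ℕ → ℂ := fun n => β * deltaZero n - chooseSeq s c n with hg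
  have hg0 : g 0 = β - 1 := by simp [hg, chooseSeq]
  have hgS : ∀ n, g (n + 1) = -chooseSeq s c (n + 1) := fun n => by
    simp [hg, deltaZero_of_ne_zero (Nat.succ_ne_zero n)]
  refine ⟨fun n => ?_, ?_, norm_conj_diffSeq_le s c β hc, exists_den_diffSeq s c β hc hβ⟩
  · -- algebraic
    rcases n with _ | n
    · rw [hg0]; exact hβ.sub isAlgebraic_one
    · rw [hgS]; exact (isAlgebraic_chooseSeq s c hc _).neg
  · -- the ODE `0·G + (c − sc) G′ + (2 + cX) G″ + X G‴ = 0`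
    refine ⟨3, ![0, Polynomial.C (c - (s : ℂ) * c),
      Polynomial.C 2 + Polynomial.C c * Polynomial.X, Polynomial.X], ?_, ?_, ?_⟩
    · intro h
      have := congr_fun h 3
      simp at this
    · have hs : IsAlgebraic ℚ ((s : ℂ)) := isAlgebraic_algebraMap (R := ℚ) (A := ℂ) s
      have h2 : IsAlgebraic ℚ (2 : ℂ) := by
        simpa using isAlgebraic_algebraMap (R := ℚ) (A := ℂ) (2 : ℚ)
      intro j k
      fin_cases j
      · simp only [Fin.zero_eta, Fin.isValue, Matrix.cons_val_zero, Polynomial.coeff_zero]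
        exact isAlgebraic_zero
      · simp only [Fin.mk_one, Fin.isValue, Matrix.cons_val_one, Matrix.cons_val_zero,
          Polynomial.coeff_C]
        split_ifs
        · exact hc.sub (hs.mul hc)
        · exact isAlgebraic_zero
      · show IsAlgebraic ℚ ((![0, Polynomial.C (c - (s : ℂ) * c),
          Polynomial.C 2 + Polynomial.C c * Polynomial.X, Polynomial.X] 2).coeff k)
        simp only [Matrix.cons_val, Polynomial.coeff_add, Polynomial.coeff_C_mul,
          Polynomial.coeff_X, Polynomial.coeff_C]
        refine IsAlgebraic.add ?_ ?_
        · split_ifs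
          · exact h2
          · exact isAlgebraic_zero
        · split_ifs
          · simpa using hc
          · simpa using isAlgebraic_zero
      · show IsAlgebraic ℚ ((![0, Polynomial.C (c - (s : ℂ) * c),
          Polynomial.C 2 + Polynomial.C c * Polynomial.X, Polynomial.X] 3).coeff k)
        simp only [Matrix.cons_val, Polynomial.coeff_X]
        split_ifs
        · exact isAlgebraic_one
        · exact isAlgebraic_zero
    · intro z
      have hode := chooseSeq_ode_deriv s c z
      have ha := expBound_chooseSeq s c
      have hgb := expBound_diffSeq s c β
      -- the derivatives of `G = eSeries g` are minus those of `F`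
      have hder : ∀ k, iteratedDeriv (k + 1) (eSeries g) z =
          -iteratedDeriv (k + 1) (eSeries (chooseSeq s c)) z := by
        intro k
        rw [iteratedDeriv_eSeries hgb (k + 1), iteratedDeriv_eSeries ha (k + 1)]
        have : (fun n => g (n + (k + 1))) = fun n => (-1) * chooseSeq s c (n + (k + 1)) := by
          funext n
          exact diffSeq_add_succ s c β n k
        rw [this, eSeries_const_mul]
        simp
      rw [Fin.sum_univ_four]
      simp only [Fin.isValue, Matrix.cons_val_zero, Polynomial.eval_zero, zero_mul, zero_add,
        Matrix.cons_val_one, Polynomial.eval_C, Matrix.cons_val, Polynomial.eval_add,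
        Polynomial.eval_mul, Polynomial.eval_X, Fin.val_one]
      have h2 : ((2 : Fin (3 + 1)) : ℕ) = 2 := rfl
      have h3 : ((3 : Fin (3 + 1)) : ℕ) = 3 := rfl
      rw [h2, h3, hder 0, hder 1, hder 2]
      linear_combination -hode

end Literature.NumberTheory.Transcendental

end
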